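import Summits.ResolutionOfSingularities.ResolutionOfSingularities.Theorems.FrobeniusLadderFRationalResolutionChartAlgebraFixedPointDim
import HarnessLib

/-!
# Crux `FrobeniusLadder.FRationalResolution` (stmt-ResolutionOfSingularities-15317), line `redirect`,
# stub `stub_diagonalizableQuotientResolution` — **the torus-fixed point over a POSITIVE-DIMENSIONAL log stratum:
# `𝔪_{C_𝔓} = I(𝔓, χ)C_𝔓 + (t₁, …, t_d)`** (first brick of design C3 = the rank-2 stratum layer of the non-isolated
# case, memo MEMO-15317-leafhand2-g10 §2 (L2); removes the zero-dimensional-stratum hypothesis `h0` of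
# `…ChartAlgebraFixedPointDim.maximalIdeal_eq_map_ideal_of_fixedPrime`)

Setting as in `…ChartAlgebraFixedPoint` / `…ChartAlgebraFixedPointDim`: a chart `φ : P → A`, a prime `𝔭` with unit
face `F_𝔭`, a chart algebra `C = A[χ(Q)]` (`χ : Q → C` extending `φ` along `P ≤ Q ⊆ ℤⁿ`, condition (S) on `Q`
relative to `ℤF_𝔭`), and a prime `𝔓` of `C` over `𝔭` containing `χ(Q ∖ ℤF_𝔭)` — the torus-fixed point over `𝔭`
(e.g. of a blow-up chart `A[I/φ(a)]`). In the surface recursion of lineage 2 the stratum of `𝔭` is a point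
(`𝔪_{A_𝔭} = I(𝔭, φ)A_𝔭`); along a stratum of dimension `d` one has instead d-form data
`𝔪_{A_𝔭} = I(𝔭, φ)A_𝔭 + (t₁, …, t_d)` (`LogChart.exists_dform_of_isLogRegularAt`). Results:
* **`maximalIdeal_eq_map_ideal_sup_span_of_fixedPrime`** — then `𝔪_{C_𝔓} = I(𝔓, χ)C_𝔓 + (t₁, …, t_d)` (images
  of the `tₖ` under the local map `A_𝔭 → C_𝔓`): Kato's ideal of the new chart plus the SAME transversal
  parameters — the d-dimensional stratum reproduces itself at the fixed point;
* `map_maximalIdeal_quotient_eq_span_of_fixedPrime` — hence modulo `I(𝔓, χ)C_𝔓` the maximal ideal of `C_𝔓` is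
  generated by the `d` classes of the `tₖ` (so `C_𝔓/I(𝔓)C_𝔓` is regular as soon as its dimension is `≥ d`, Kato (2.1)(i));
* **`exists_dform_fixedPrime_of_isLogRegularAt`** — for `φ` LOG REGULAR at `𝔭`: d-form data at `𝔭` with
  `dim A_𝔭 = d + (n − rk F_𝔭)` transported to `𝔓`, together with Kato's inequality
  `dim C_𝔓 ≤ (n − rk F_𝔓(χ)) + d` (`…ringKrullDim_le_rank_add_of_fixedPrime`). What (L2) of the memo still
  needs on top of this file is the LOWER bound `dim C_𝔓 ≥ (n − rk F_𝔓(χ)) + d` (surface count at the generic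
  point of the stratum + chain concatenation), after which `χ` is log regular at `𝔓` by Kato (2.1).

Honest label: generic local algebra toward ONE leaf stub (no stub, crux or summit closed). No definitions, no
named facts, no sorry. [cite: Kato1994, Def. (2.1), Lemma (2.3), (10.1)] [cite: Niziol2006, §4]
-/

noncomputable section

-- single-problem summit: the doubled namespace component is forced
set_option linter.dupNamespace false

open IsLocalRing Literature.AlgebraicGeometry.Resolution Literature.AlgebraicGeometry.Resolution.LogChart
open Summit.ResolutionOfSingularities.ResolutionOfSingularities.Theorems.FRationalResolution.ChartAlgebraFixedPoint
open Summit.ResolutionOfSingularities.ResolutionOfSingularities.Theorems.FRationalResolution.ChartAlgebraFixedPointDim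

namespace Summit.ResolutionOfSingularities.ResolutionOfSingularities.Theorems.FRationalResolution.FixedStratumMaximalIdeal

universe u

variable {A : Type u} [CommRing A] {n : ℕ} {P : AddSubmonoid (Fin n → ℤ)} {φ : Multiplicative P →* A}
  {𝔭 : Ideal A} [𝔭.IsPrime] {C : Type u} [CommRing C] [Algebra A C] {Q : AddSubmonoid (Fin n → ℤ)}
  {χ : Multiplicative Q →* C} {𝔓 : Ideal C} [𝔓.IsPrime]

/-- **The fixed point over a stratum with d-form data: `𝔪_{C_𝔓} = I(𝔓, χ)C_𝔓 + (t₁, …, t_d)`.** If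
`𝔪_{A_𝔭} ≤ I(𝔭, φ)A_𝔭 + (t₁, …, t_d)` with `tₖ ∈ 𝔪_{A_𝔭}`, then at a prime `𝔓` of `C = A[χ(Q)]` over `𝔭`
containing `χ(Q ∖ ℤF_𝔭)` the maximal ideal of `C_𝔓` is Kato's ideal of `χ` plus the images of the `tₖ`.
[cite: Kato1994, Def. (2.1), (10.1)] -/
theorem maximalIdeal_eq_map_ideal_sup_span_of_fixedPrime (hPQ : P ≤ Q)
    (hχ : ∀ p : P, χ (Multiplicative.ofAdd ⟨(p : Fin n → ℤ), hPQ p.2⟩) =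
      algebraMap A C (φ (Multiplicative.ofAdd p)))
    (hgen : Algebra.adjoin A (Set.range χ) = ⊤)
    (hS : ∀ q₁ ∈ Q, ∀ q₂ ∈ Q, q₁ + q₂ ∈ Submodule.span ℤ (faceMonoid P φ 𝔭 : Set (Fin n → ℤ)) →
      q₁ ∈ Submodule.span ℤ (faceMonoid P φ 𝔭 : Set (Fin n → ℤ)))
    (h𝔓 : 𝔓.comap (algebraMap A C) = 𝔭)
    (hq : ∀ q : Q, (q : Fin n → ℤ) ∉ Submodule.span ℤ (faceMonoid P φ 𝔭 : Set (Fin n → ℤ)) →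
      χ (Multiplicative.ofAdd q) ∈ 𝔓)
    {d : ℕ} {t : Fin d → Localization.AtPrime 𝔭} (ht : ∀ k, t k ∈ maximalIdeal (Localization.AtPrime 𝔭))
    (hgen𝔭 : maximalIdeal (Localization.AtPrime 𝔭) ≤
      (ideal P φ 𝔭).map (algebraMap A (Localization.AtPrime 𝔭)) ⊔ Ideal.span (Set.range t)) :
    maximalIdeal (Localization.AtPrime 𝔓) =
      (ideal Q χ 𝔓).map (algebraMap C (Localization.AtPrime 𝔓)) ⊔
        Ideal.span (Set.range fun k => Localization.localRingHom 𝔭 𝔓 (algebraMap A C) h𝔓.symm (t k)) := by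
  refine le_antisymm ?_ ?_
  · rw [maximalIdeal_eq_sup_map hPQ hχ hgen hS h𝔓 hq]
    exact sup_le (map_prime_le_of_dform hPQ hχ h𝔓 hgen𝔭) le_sup_left
  · refine sup_le ?_ ?_
    · rw [← Localization.AtPrime.map_eq_maximalIdeal]
      exact Ideal.map_mono (ideal_le Q χ 𝔓)
    · rw [Ideal.span_le]
      rintro _ ⟨k, rfl⟩
      haveI : IsLocalHom (Localization.localRingHom 𝔭 𝔓 (algebraMap A C) h𝔓.symm) :=
        Localization.isLocalHom_localRingHom 𝔭 𝔓 (algebraMap A C) h𝔓.symm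
      exact map_nonunit (Localization.localRingHom 𝔭 𝔓 (algebraMap A C) h𝔓.symm) (t k) (ht k)

/-- **Kato's condition (2.1)(i), generator half: modulo `I(𝔓, χ)C_𝔓` the maximal ideal of `C_𝔓` is generated by
the `d` classes of the transversal parameters `tₖ`** (so `C_𝔓/I(𝔓)C_𝔓`, a local ring whose maximal ideal is the
image of `𝔪_{C_𝔓}`, is regular as soon as its dimension is `≥ d`). [cite: Kato1994, Def. (2.1)] -/
theorem map_maximalIdeal_quotient_eq_span_of_fixedPrime (hPQ : P ≤ Q)
    (hχ : ∀ p : P, χ (Multiplicative.ofAdd ⟨(p : Fin n → ℤ), hPQ p.2⟩) =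
      algebraMap A C (φ (Multiplicative.ofAdd p)))
    (hgen : Algebra.adjoin A (Set.range χ) = ⊤)
    (hS : ∀ q₁ ∈ Q, ∀ q₂ ∈ Q, q₁ + q₂ ∈ Submodule.span ℤ (faceMonoid P φ 𝔭 : Set (Fin n → ℤ)) →
      q₁ ∈ Submodule.span ℤ (faceMonoid P φ 𝔭 : Set (Fin n → ℤ)))
    (h𝔓 : 𝔓.comap (algebraMap A C) = 𝔭)
    (hq : ∀ q : Q, (q : Fin n → ℤ) ∉ Submodule.span ℤ (faceMonoid P φ 𝔭 : Set (Fin n → ℤ)) →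
      χ (Multiplicative.ofAdd q) ∈ 𝔓)
    {d : ℕ} {t : Fin d → Localization.AtPrime 𝔭} (ht : ∀ k, t k ∈ maximalIdeal (Localization.AtPrime 𝔭))
    (hgen𝔭 : maximalIdeal (Localization.AtPrime 𝔭) ≤
      (ideal P φ 𝔭).map (algebraMap A (Localization.AtPrime 𝔭)) ⊔ Ideal.span (Set.range t)) :
    (maximalIdeal (Localization.AtPrime 𝔓)).map
        (Ideal.Quotient.mk ((ideal Q χ 𝔓).map (algebraMap C (Localization.AtPrime 𝔓)))) =
      Ideal.span (Set.range fun k =>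
        Ideal.Quotient.mk ((ideal Q χ 𝔓).map (algebraMap C (Localization.AtPrime 𝔓)))
          (Localization.localRingHom 𝔭 𝔓 (algebraMap A C) h𝔓.symm (t k))) := by
  rw [maximalIdeal_eq_map_ideal_sup_span_of_fixedPrime hPQ hχ hgen hS h𝔓 hq ht hgen𝔭, Ideal.map_sup,
    Ideal.map_quotient_self, bot_sup_eq, Ideal.map_span, ← Set.range_comp]
  rfl

/-- **d-form data at the fixed point of a chart algebra over a LOG REGULAR point.** For `φ` log regular at `𝔭`
there are `d` and `t₁, …, t_d ∈ 𝔪_{A_𝔭}` with `𝔪_{A_𝔭} ≤ I(𝔭)A_𝔭 + (t)`, `dim A_𝔭 = d + (n − rk F_𝔭(φ))`, and at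
every prime `𝔓` of `C = A[χ(Q)]` over `𝔭` containing `χ(Q ∖ ℤF_𝔭)` (`Q` finitely generated and saturated, `C`
Noetherian, (S)): `𝔪_{C_𝔓} = I(𝔓)C_𝔓 + (t)` and `dim C_𝔓 ≤ (n − rk F_𝔓(χ)) + d`.
[cite: Kato1994, Def. (2.1), Lemma (2.3), (10.1)] -/
theorem exists_dform_fixedPrime_of_isLogRegularAt [IsNoetherianRing C] (hQ : Q.FG)
    (hsatQ : ∀ (v : Fin n → ℤ) (k : ℕ), 0 < k → k • v ∈ Q → v ∈ Q) (hPQ : P ≤ Q)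
    (hχ : ∀ p : P, χ (Multiplicative.ofAdd ⟨(p : Fin n → ℤ), hPQ p.2⟩) =
      algebraMap A C (φ (Multiplicative.ofAdd p)))
    (hgen : Algebra.adjoin A (Set.range χ) = ⊤)
    (hS : ∀ q₁ ∈ Q, ∀ q₂ ∈ Q, q₁ + q₂ ∈ Submodule.span ℤ (faceMonoid P φ 𝔭 : Set (Fin n → ℤ)) →
      q₁ ∈ Submodule.span ℤ (faceMonoid P φ 𝔭 : Set (Fin n → ℤ)))
    (hreg : IsLogRegularAt P φ 𝔭) (h𝔓 : 𝔓.comap (algebraMap A C) = 𝔭)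
    (hq : ∀ q : Q, (q : Fin n → ℤ) ∉ Submodule.span ℤ (faceMonoid P φ 𝔭 : Set (Fin n → ℤ)) →
      χ (Multiplicative.ofAdd q) ∈ 𝔓) :
    ∃ (d : ℕ) (t : Fin d → Localization.AtPrime 𝔭),
      (∀ k, t k ∈ maximalIdeal (Localization.AtPrime 𝔭)) ∧
      ringKrullDim (Localization.AtPrime 𝔭) =
        ((d + (n - Module.finrank ℤ (Submodule.span ℤ (faceMonoid P φ 𝔭 : Set (Fin n → ℤ)))) : ℕ) :
          WithBot ℕ∞) ∧
      maximalIdeal (Localization.AtPrime 𝔓) =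
        (ideal Q χ 𝔓).map (algebraMap C (Localization.AtPrime 𝔓)) ⊔
          Ideal.span (Set.range fun k => Localization.localRingHom 𝔭 𝔓 (algebraMap A C) h𝔓.symm (t k)) ∧
      ringKrullDim (Localization.AtPrime 𝔓) ≤
        ((n - Module.finrank ℤ (Submodule.span ℤ (faceMonoid Q χ 𝔓 : Set (Fin n → ℤ))) + d : ℕ) :
          WithBot ℕ∞) := by
  obtain ⟨d, t, ht, hgen𝔭, hdim⟩ := exists_dform_of_isLogRegularAt P φ 𝔭 hreg
  exact ⟨d, t, ht, hdim, maximalIdeal_eq_map_ideal_sup_span_of_fixedPrime hPQ hχ hgen hS h𝔓 hq ht hgen𝔭,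
    ringKrullDim_le_rank_add_of_fixedPrime hQ hsatQ hPQ hχ hgen hS h𝔓 hq ht hgen𝔭⟩

end Summit.ResolutionOfSingularities.ResolutionOfSingularities.Theorems.FRationalResolution.FixedStratumMaximalIdeal

end
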